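import Summits.Ventures.HodgeKum4.Theorems.KummerFixedLocusL1Defs
import Summits.Ventures.HodgeKum4.Theorems.KummerFixedLocusInvolutionParity
import Literature.Computation.KummerOrbifold.Model5
import Literature.AlgebraicGeometry.Hyperkaehler.LLVStructureKummerType
import HarnessLib

/-!
# Route KummerFixedLocus (`hodge-kum4`, rung H3) — L1 `LefschetzGenerationKum4`: kernel proofs

Seat p1.  PROVED here (sorry-free), for item stmt-Ventures-19134
(`Summit.Ventures.HodgeKum4.LefschetzGenerationKum4`), CONDITIONALLY on the named hypotheses
`KummerOrbifoldModelKum4` (MODEL_X, route-item candidate, `Theorems/KummerFixedLocusL1Defs`),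
`FrameComplementKum4` (kernel-derivable, ibid.), the REFEREED Looijenga–Lunts–Verbitsky structure fact
`LooijengaLuntsVerbitsky_llvStructure_kumType` (Literature), and — for the `Γ(X)` form — the PRINT frame
existence `KummerTranslationFrameExists` (`Invariants.lean`):

* KERNEL LEMMAS: `invariantClasses_isCupClosed` (via seat p2's `totalPullback_totalCup`),
  `totalPullback_degreeOperator`, `degreeOperator_mem_invariantClasses` (invariants of self-maps are
  cup-closed and `h`-stable);
* **`le_llvCupSpan_of_modelCore`** (TRANSPORT, abstract over `Y`, `Inv`): `ModelCore Inv` + a complement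
  killed by `h` and `L_{H²}` ⟹ `Inv ≤ llvCupSpan ℂ Y 8 (degreeClasses ℂ Y {0,2,3})`.  Proof: transport
  `Λ₀` through `φ` and extend by `0` on `N'`; the certified identities `[L_{ω₀}, Λ₀] = h`,
  `[h, Λ₀] = -2Λ₀` (`Computation/KummerOrbifold/Model5`, from `certificate5`: `native_decide` over all
  `70177` raw basis vectors) make `(L_{x₀}, h, Λ)` an `sl₂`-triple, so `Λ ∈ g_tot` and the target span is
  `Λ`-stable; `φ(T ∩ Inv)` contains the seeds and is stable under `Λ₀` and the `genOp j`, hence contains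
  `C₀ = φ(Inv)` by minimality.  No rank, dimension or spanning fact enters the kernel;
* LieGen (`g_tot ≤ Lie⟨L_{H²}, Λ⟩`) enters through `LooijengaLuntsVerbitsky_llvStructure_kumType.llvAlgebra_le_lieSpan`
  (kernel theorem of `Literature/…/LLVStructureKummerType`);
* closers `lefschetzGenerationKum4Frame_of_model` (frame form) and
  **`lefschetzGenerationKum4_of_model : KummerOrbifoldModelKum4 → FrameComplementKum4 →
  LooijengaLuntsVerbitsky_llvStructure_kumType → KummerTranslationFrameExists →
  Summit.Ventures.HodgeKum4.LefschetzGenerationKum4`**.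
-/

namespace Summit.Ventures.HodgeKum4

open CategoryTheory
open Literature.AlgebraicGeometry Literature.AlgebraicGeometry.Hyperkaehler
open Literature.AlgebraicGeometry.HodgeTheory
open Literature.AlgebraicTopology.SingularHomology
open Literature.Computation.KummerOrbifold Literature.Computation.Sparse

universe u

section Abstract

variable {Y : Type u} [TopologicalSpace Y]

/-! ### Invariant classes are cup-closed and `h`-stable -/

/-- The invariants of a family of self-maps are closed under cup product. [cite: Hatcher2002, Prop. 3.10] -/
theorem invariantClasses_isCupClosed (𝓕 : Set C(Y, Y)) : IsCupClosed (invariantClasses ℂ 𝓕) := by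
  intro x hx y hy
  rw [mem_invariantClasses_iff] at hx hy ⊢
  intro f hf
  rw [totalPullback_totalCup, hx f hf, hy f hf]

/-- Pull-back commutes with the degree operator (it preserves degrees). [cite: Hatcher2002, §3.1 (induced homomorphisms are graded)] -/
theorem totalPullback_degreeOperator (f : C(Y, Y)) (N : ℕ) (v : totalCohomology ℂ Y) :
    totalPullback ℂ f (degreeOperator ℂ Y N v) = degreeOperator ℂ Y N (totalPullback ℂ f v) := by
  have : totalPullback ℂ f ∘ₗ degreeOperator ℂ Y N = degreeOperator ℂ Y N ∘ₗ totalPullback ℂ f := by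
    refine DirectSum.linearMap_ext ℂ fun k ↦ LinearMap.ext fun x ↦ ?_
    simp only [LinearMap.coe_comp, Function.comp_apply, degreeOperator_lof, map_smul, totalPullback_lof]
  exact congrArg (fun F ↦ F v) this

/-- The invariants of a family of self-maps are stable under the degree operator. [cite: Hatcher2002, §3.1 (induced homomorphisms are graded)] -/
theorem degreeOperator_mem_invariantClasses (𝓕 : Set C(Y, Y)) (N : ℕ) {v : totalCohomology ℂ Y}
    (hv : v ∈ invariantClasses ℂ 𝓕) : degreeOperator ℂ Y N v ∈ invariantClasses ℂ 𝓕 := by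
  rw [mem_invariantClasses_iff] at hv ⊢
  intro f hf
  rw [totalPullback_degreeOperator, hv f hf]


/-! ### The transport theorem -/

/-- **Transport theorem.**  Under `ModelCore Inv` and a complement of `Inv` killed by `h` and by the
Lefschetz operators, a cup-closed, `h`-stable `Inv` lies in the `(g_tot, ∪)`-span of `H⁰ ⊕ H² ⊕ H³`. -/
theorem le_llvCupSpan_of_modelCore (Inv : Submodule ℂ (totalCohomology ℂ Y))
    (hcup : IsCupClosed Inv) (hdeg : ∀ y ∈ Inv, degreeOperator ℂ Y 8 y ∈ Inv)
    (hM : ModelCore Inv) (N' : Submodule ℂ (totalCohomology ℂ Y)) (hc : IsCompl Inv N')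
    (hNh : ∀ n ∈ N', degreeOperator ℂ Y 8 n = 0)
    (hNL' : ∀ (x : singularCohomology ℂ ℂ Y 2), ∀ n ∈ N', totalLefschetz x n = 0) :
    Inv ≤ llvCupSpan ℂ Y 8 (degreeClasses ℂ Y {0, 2, 3}) := by
  obtain ⟨φ, x₀, hx₀, hinj, hrange, hφx₀, hgr, hseeds, hmult⟩ := hM
  have hNL : ∀ n ∈ N', totalLefschetz x₀ n = 0 := hNL' x₀
  classical
  set H := totalCohomology ℂ Y with hH
  set T := llvCupSpan ℂ Y 8 (degreeClasses ℂ Y {0, 2, 3}) with hT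
  -- membership of images in C₀
  have hmemC : ∀ y : Inv, φ y ∈ modelSpace ℂ := fun y ↦ hrange ▸ LinearMap.mem_range_self φ y
  -- Λ on Inv: Λi y := φ⁻¹ (Λ₀ (φ y))
  have hpre : ∀ y : Inv, ∃ z : Inv, φ z = lamOp ℂ (φ y) := fun y ↦ by
    have : lamOp ℂ (φ y) ∈ LinearMap.range φ := hrange ▸ lamOp_mem ℂ (hmemC y)
    obtain ⟨z, hz⟩ := this
    exact ⟨z, hz⟩
  choose Λf hΛf using hpre
  -- Λf is additive and homogeneous (by injectivity of φ)
  let Λi : Inv →ₗ[ℂ] Inv :=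
    { toFun := Λf
      map_add' := fun a b ↦ hinj (by rw [hΛf, map_add, map_add, map_add, hΛf, hΛf])
      map_smul' := fun c a ↦ hinj (by rw [hΛf, map_smul, map_smul, map_smul, hΛf]; rfl) }
  have hΛi : ∀ y : Inv, φ (Λi y) = lamOp ℂ (φ y) := hΛf
  -- Λ on H: Λi on Inv, 0 on N'
  let Λ : Module.End ℂ H := LinearMap.ofIsCompl hc (Inv.subtype ∘ₗ Λi) 0
  have hΛleft : ∀ y : Inv, Λ (y : H) = (Λi y : H) := fun y ↦ by
    simp only [Λ, LinearMap.ofIsCompl_apply_left, LinearMap.coe_comp, Submodule.coe_subtype,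
      Function.comp_apply]
  have hΛright : ∀ n : N', Λ (n : H) = 0 := fun n ↦ by
    simp only [Λ, LinearMap.ofIsCompl_apply_right, LinearMap.zero_apply]
  -- L_{x₀} on Inv corresponds to lefOp
  have hLmem : ∀ y ∈ Inv, totalLefschetz x₀ y ∈ Inv := fun y hy ↦ by
    rw [totalLefschetz_eq_totalCup]; exact hcup _ hx₀ _ hy
  have hφL : ∀ (y : H) (hy : y ∈ Inv),
      φ ⟨totalLefschetz x₀ y, hLmem y hy⟩ = lefOp ℂ (φ ⟨y, hy⟩) := fun y hy ↦ by
    have hxy : totalCup ℂ Y (ofDegree ℂ Y 2 x₀) y ∈ Inv := hcup _ hx₀ _ hy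
    have h1 := hmult 15 (by norm_num) _ hx₀ hφx₀ y hy hxy
    have h2 : (⟨totalLefschetz x₀ y, hLmem y hy⟩ : Inv) = ⟨totalCup ℂ Y (ofDegree ℂ Y 2 x₀) y, hxy⟩ := by
      apply Subtype.ext
      simp only [totalLefschetz_eq_totalCup]
    rw [h2, h1]; rfl
  -- decomposition along Inv ⊕ N'
  have hdecomp : ∀ v : H, ∃ (y : Inv) (n : N'), v = (y : H) + (n : H) := fun v ↦ by
    have hv : v ∈ Inv ⊔ N' := by rw [hc.sup_eq_top]; exact Submodule.mem_top
    obtain ⟨y, hy, n, hn, hyn⟩ := Submodule.mem_sup.mp hv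
    exact ⟨⟨y, hy⟩, ⟨n, hn⟩, hyn.symm⟩
  -- IsDualLefschetz 8 x₀ Λ
  have hdual : IsDualLefschetz 8 x₀ Λ := by
    rw [isDualLefschetz_iff]
    refine ⟨?_, ?_, ?_⟩
    · -- h ≠ 0: seed 0 has a homogeneous preimage of degree k ∈ {0,2,3}, and seedVec 0 ≠ 0
      obtain ⟨k, hk, x, hx, hφx⟩ := hseeds 0
      intro h0
      have hx0 : ofDegree ℂ Y k x ≠ 0 := by
        intro hz
        apply seedVec_zero_ne_zero ℂ
        rw [← hφx]
        have : (⟨ofDegree ℂ Y k x, hx⟩ : Inv) = 0 := Subtype.ext hz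
        rw [this, map_zero]
      have hk8 : ((k : ℂ) - 8) ≠ 0 := by
        have hk' : k = 0 ∨ k = 2 ∨ k = 3 := by simpa using hk
        rcases hk' with rfl | rfl | rfl <;> norm_num
      have := congrArg (fun f ↦ f (ofDegree ℂ Y k x)) h0
      simp only [degreeOperator_lof, LinearMap.zero_apply, smul_eq_zero] at this
      exact this.elim hk8 hx0
    · -- ⁅L, Λ⁆ = h
      refine LinearMap.ext fun v ↦ ?_
      obtain ⟨y, n, rfl⟩ := hdecomp v
      have hyI : (y : H) ∈ Inv := y.2
      have hyeta : (⟨(y : H), hyI⟩ : Inv) = y := Subtype.ext rfl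
      -- the Inv part
      have hA : totalLefschetz x₀ (Λ (y : H)) - Λ (totalLefschetz x₀ (y : H)) =
          degreeOperator ℂ Y 8 (y : H) := by
        have hLy : totalLefschetz x₀ (y : H) ∈ Inv := hLmem _ hyI
        rw [hΛleft y, hΛleft ⟨_, hLy⟩]
        set a : Inv := ⟨totalLefschetz x₀ (Λi y : H), hLmem _ (Λi y).2⟩ with ha_def
        set b : Inv := Λi ⟨_, hLy⟩ with hb_def
        set c : Inv := ⟨degreeOperator ℂ Y 8 (y : H), hdeg _ hyI⟩ with hc_def
        have ha : φ a = lefOp ℂ (lamOp ℂ (φ y)) := by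
          rw [ha_def, hφL _ (Λi y).2, ← hΛi y]
        have hb : φ b = lamOp ℂ (lefOp ℂ (φ y)) := by
          rw [hb_def, hΛi, hφL _ hyI, hyeta]
        have hc' : φ c = degOp ℂ (φ y) := by
          rw [hc_def, hgr _ hyI (hdeg _ hyI), hyeta]
        have habc : a - b = c := hinj (by rw [map_sub, ha, hb, hc', lef_lam_apply])
        have := congrArg Subtype.val habc
        simpa [ha_def, hb_def, hc_def] using this
      -- the N' part vanishes
      have hB : totalLefschetz x₀ (Λ (n : H)) - Λ (totalLefschetz x₀ (n : H)) =
          degreeOperator ℂ Y 8 (n : H) := by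
        rw [hΛright n, hNL _ n.2, hNh _ n.2, map_zero, map_zero, sub_zero]
      simp only [Ring.lie_def, LinearMap.sub_apply, Module.End.mul_apply, map_add]
      rw [← hA, ← hB]
    · -- ⁅h, Λ⁆ = -(2 • Λ)
      refine LinearMap.ext fun v ↦ ?_
      obtain ⟨y, n, rfl⟩ := hdecomp v
      have hyI : (y : H) ∈ Inv := y.2
      have hyeta : (⟨(y : H), hyI⟩ : Inv) = y := Subtype.ext rfl
      have hA : degreeOperator ℂ Y 8 (Λ (y : H)) - Λ (degreeOperator ℂ Y 8 (y : H)) =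
          -(2 • Λ (y : H)) := by
        have hhy : degreeOperator ℂ Y 8 (y : H) ∈ Inv := hdeg _ hyI
        rw [hΛleft y, hΛleft ⟨_, hhy⟩]
        set a : Inv := ⟨degreeOperator ℂ Y 8 (Λi y : H), hdeg _ (Λi y).2⟩ with ha_def
        set b : Inv := Λi ⟨_, hhy⟩ with hb_def
        have ha : φ a = degOp ℂ (lamOp ℂ (φ y)) := by
          rw [ha_def, hgr _ (Λi y).2 (hdeg _ (Λi y).2), ← hΛi y]
        have hb : φ b = lamOp ℂ (degOp ℂ (φ y)) := by
          rw [hb_def, hΛi, hgr _ hyI hhy, hyeta]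
        have habc : a - b = (-2 : ℂ) • Λi y :=
          hinj (by rw [map_sub, ha, hb, map_smul, hΛi, deg_lam_apply])
        have := congrArg Subtype.val habc
        simp only [ha_def, hb_def, Submodule.coe_sub, SetLike.val_smul] at this
        rw [this, neg_smul, two_smul, two_smul]
      have hB : degreeOperator ℂ Y 8 (Λ (n : H)) - Λ (degreeOperator ℂ Y 8 (n : H)) =
          -(2 • Λ (n : H)) := by
        rw [hΛright n, hNh _ n.2, map_zero, map_zero, sub_zero, smul_zero, neg_zero]
      simp only [Ring.lie_def, LinearMap.sub_apply, Module.End.mul_apply, map_add, LinearMap.neg_apply,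
        LinearMap.smul_apply]
      rw [← hA, ← hB]
  -- T is Λ-stable
  have hTΛ : ∀ v ∈ T, Λ v ∈ T := fun v hv ↦
    (mem_stabilizerLie_iff T Λ).mp (llvAlgebra_le_stabilizerLie_llvCupSpan (dual_mem hdual)) v hv
  -- the closure argument: S' = φ(T ∩ Inv)
  let S' : Submodule ℂ (ℕ →₀ ℂ) := (T.comap Inv.subtype).map φ
  have hS'mem : ∀ (y : H) (hy : y ∈ Inv), y ∈ T → φ ⟨y, hy⟩ ∈ S' := fun y hy hyT ↦
    Submodule.mem_map.mpr ⟨⟨y, hy⟩, by simpa using hyT, rfl⟩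
  have hS'out : ∀ v ∈ S', ∃ (y : H) (hy : y ∈ Inv), y ∈ T ∧ φ ⟨y, hy⟩ = v := fun v hv ↦ by
    obtain ⟨y, hyT, hyv⟩ := Submodule.mem_map.mp hv
    exact ⟨y, y.2, by simpa using hyT, hyv⟩
  have hTdeg : ∀ {k : ℕ}, k ∈ ({0, 2, 3} : Set ℕ) → ∀ x : singularCohomology ℂ ℂ Y k,
      ofDegree ℂ Y k x ∈ T := fun hk x ↦ subset_llvCupSpan (ofDegree_mem_degreeClasses hk x)
  have hle : modelSpace ℂ ≤ S' := by
    refine modelSpace_le ℂ (fun s ↦ ?_) (fun v hv ↦ ?_) (fun j hj v hv ↦ ?_)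
    · obtain ⟨k, hk, x, hx, hφx⟩ := hseeds s
      rw [← hφx]
      exact hS'mem _ hx (hTdeg hk x)
    · obtain ⟨y, hy, hyT, rfl⟩ := hS'out v hv
      have e3 : (⟨y, hy⟩ : Inv) = (⟨y, hy⟩ : Inv) := rfl
      rw [← hΛi]
      have hmem : (Λi ⟨y, hy⟩ : H) ∈ T := by
        rw [← hΛleft]; exact hTΛ _ hyT
      have : Λi ⟨y, hy⟩ = ⟨(Λi ⟨y, hy⟩ : H), (Λi ⟨y, hy⟩).2⟩ := Subtype.ext rfl
      rw [this]
      exact hS'mem _ _ hmem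
    · obtain ⟨y, hy, hyT, rfl⟩ := hS'out v hv
      obtain ⟨k, hk, x, hx, hφx⟩ := hseeds (j + 1)
      have hxy : totalCup ℂ Y (ofDegree ℂ Y k x) y ∈ Inv := hcup _ hx _ hy
      rw [← hmult j hj _ hx hφx y hy hxy]
      exact hS'mem _ hxy (isCupClosed_llvCupSpan _ (hTdeg hk x) _ hyT)
  -- conclusion
  intro y hy
  have hyC : φ ⟨y, hy⟩ ∈ S' := hle (hmemC ⟨y, hy⟩)
  obtain ⟨y', hy', hy'T, hφ⟩ := hS'out _ hyC
  have := congrArg Subtype.val (hinj hφ)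
  simp only at this
  rw [← this]
  exact hy'T

end Abstract

/-- **L1, frame form (kernel, conditional on MODEL_X, the frame complement and the LLV structure
fact).** -/
theorem lefschetzGenerationKum4Frame_of_model (hM : KummerOrbifoldModelKum4) (hC : FrameComplementKum4)
    (hF : LooijengaLuntsVerbitsky_llvStructure_kumType) :
    Summit.Ventures.HodgeKum4.LefschetzGenerationKum4Frame := by
  intro X g hX hK hg ℓ Λ hΛ
  obtain ⟨N', hc, hNh, hNL⟩ := hC g hX hK hg
  have h1 : frameInvariants X g ≤
      llvCupSpan ℂ (Motives.ComplexPoints X) 8 (degreeClasses ℂ (Motives.ComplexPoints X) {0, 2, 3}) :=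
    le_llvCupSpan_of_modelCore (frameInvariants X g) (invariantClasses_isCupClosed _)
      (fun y hy ↦ degreeOperator_mem_invariantClasses _ 8 hy) (hM g hX hK hg) N' hc hNh hNL
  -- LieGen (kernel, from the REFEREED LLV structure theorem): `g_tot ≤ Lie⟨L_{H²}, Λ⟩`
  refine le_trans h1 (llvCupSpan_le_opCupSpan
    (LooijengaLuntsVerbitsky_llvStructure_kumType.llvAlgebra_le_lieSpan hF (n := 4) (by norm_num) hX hK ℓ Λ hΛ)
    fun a ↦ ?_)
  exact ofDegree_mem_degreeClasses (by simp) a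

/-- **L1 = `LefschetzGenerationKum4` (kernel, conditional on MODEL_X, the frame complement, the LLV
structure fact and frame existence)** — the closer of item stmt-Ventures-19134. -/
theorem lefschetzGenerationKum4_of_model (hM : KummerOrbifoldModelKum4) (hC : FrameComplementKum4)
    (hF : LooijengaLuntsVerbitsky_llvStructure_kumType) (hex : KummerTranslationFrameExists) :
    Summit.Ventures.HodgeKum4.LefschetzGenerationKum4 :=
  lefschetzGenerationKum4_of_frame hex (lefschetzGenerationKum4Frame_of_model hM hC hF)

end Summit.Ventures.HodgeKum4
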